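import Summits.MatrixMultiplication.OmegaCensus.BoxBadSmallGroups2

/-!
# ω-census, family (b3): conjecture C9 — the metacyclic group `M(p³) = ℤ/p² ⋊ ℤ/p`: model, height identity and pattern lemma

HONEST FRAMING (pub-omega census; verbatim): lottery ticket; floor = certified bounds/negative ranges.
Census BOOKKEEPING (conjecture C9 of the cell; pub-omega stpp-1 gen 19).  The twin of the Heisenberg family: `Mcube p` is the
kernel model of `M(p³) = ⟨a, b | a^{p²} = b^p = 1, b a b⁻¹ = a^{1+p}⟩` as pairs `(t, x) ∈ ℤ/p × ℤ/p²` with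
`(t,x)(t',x') = (t+t', x+x'+p·t̂·x')` (`t̂ = t.val`; group axioms PROVED for every `p`; order `p³`, centre `pℤ/p²` of index
`p²`; minimal non-abelian: every proper section abelian — UNFORCED for every `p`).  As for `Heis p` (`HeisenbergPattern`) the
independence of a cell set in a `3 × 3` box reduces to a PATTERN condition on heights: for an integer box `IBox` (`y_k = (θ_k, η_k)`,
`w_l = (φ_l, ω_l)`) the cell of column `(k,l)` over the class `(t₀, K₁)` at height `h` is
`(t₀ − θ_k − φ_l, K₁ − η_k − ω_l + p(h − (θ_k+φ_l)K₁))` (`cellM`), and the KEY IDENTITIES (`dvd_of_cellWord`,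
`dvd_height_of_cellWord`, an exact polynomial identity modulo `p²`, remainder `Rsub` machine-derived and `ring`-checked) give:
interaction ⟹ same class AND `h − h' ≡ tauI` where **`tauI(c,c′) = (θ_k−θ_k′)(η_k+η_k′+ω_l′) + (φ_l−φ_l′)(η_k+ω_l+ω_l′)`** (mod `p`).
Hence `IBox.not_boxUseful_of_pattern`: an independent height pattern `T` with `9p ≤ 5·#T` makes `Mcube p` not box-useful;
first instance `not_boxUseful_mcube5` (`p = 5`, optimal pattern of `10 = 2·5` heights, `decide`).  The uniform family (all odd
`p`; numerically settled in the seat's CLOSEOUT: intervals for `p ≥ 41`, explicit patterns below) is the successor's file.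
Nothing here is progress on `ω`.
-/

namespace Summit.MatrixMultiplication.OmegaCensus

open Finset ProductBoxBound

/-- `M(p³)`: pairs `(t, x) ∈ ℤ/p × ℤ/p²`, `b^t a^x` with `b a b⁻¹ = a^{1+p}`. [folklore] -/
structure Mcube (p : ℕ) where
  /-- exponent of `b` (acts on `⟨a⟩ = ℤ/p²` by `1 + p`) -/
  t : ZMod p
  /-- exponent of `a` -/
  x : ZMod (p ^ 2)
  deriving DecidableEq

namespace Mcube

variable {p : ℕ}

/-- Two elements agree iff both coordinates agree. [folklore] -/
@[ext] theorem ext {g h : Mcube p} (ht : g.t = h.t) (hx : g.x = h.x) : g = h := by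
  cases g; cases h; congr

/-- The set-theoretic section `ℤ/p → ℤ/p²`, `t ↦ t.val`. [folklore] -/
def L (t : ZMod p) : ZMod (p ^ 2) := ((t.val : ℕ) : ZMod (p ^ 2))

/-- Product `(t,x)(t',x') = (t+t', x + x' + p·t̂·x')` (`(1+p)^t = 1 + p t`). [folklore] -/
instance : Mul (Mcube p) := ⟨fun g h => ⟨g.t + h.t, g.x + h.x + (p : ZMod (p ^ 2)) * L g.t * h.x⟩⟩
/-- Identity. [folklore] -/
instance : One (Mcube p) := ⟨⟨0, 0⟩⟩
/-- Inverse `(t,x)⁻¹ = (−t, −x + p t̂ x)`. [folklore] -/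
instance : Inv (Mcube p) := ⟨fun g => ⟨-g.t, -g.x + (p : ZMod (p ^ 2)) * L g.t * g.x⟩⟩

/-- The multiplication rule, unfolded. [folklore] -/
theorem mul_def (g h : Mcube p) : g * h = ⟨g.t + h.t, g.x + h.x + (p : ZMod (p ^ 2)) * L g.t * h.x⟩ := rfl
/-- The identity, unfolded. [folklore] -/
theorem one_def : (1 : Mcube p) = ⟨0, 0⟩ := rfl
/-- The inverse, unfolded. [folklore] -/
theorem inv_def (g : Mcube p) : g⁻¹ = ⟨-g.t, -g.x + (p : ZMod (p ^ 2)) * L g.t * g.x⟩ := rfl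

/-- `p·p = 0` in `ℤ/p²`. [folklore] -/
theorem pp_eq_zero : (p : ZMod (p ^ 2)) * (p : ZMod (p ^ 2)) = 0 := by
  rw [← Nat.cast_mul, ← pow_two, ZMod.natCast_self]

/-- **Core congruence**: `p · (T mod p)^ = p · T` in `ℤ/p²` for an integer `T`. [folklore] -/
theorem p_mul_L_intCast [NeZero p] (T : ℤ) :
    (p : ZMod (p ^ 2)) * L ((T : ZMod p)) = (p : ZMod (p ^ 2)) * (T : ZMod (p ^ 2)) := by
  have hv : (((T : ZMod p).val : ℕ) : ZMod (p ^ 2)) = ((((T : ZMod p).val : ℕ) : ℤ) : ZMod (p ^ 2)) := by push_cast; rfl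
  rw [L, hv, ZMod.val_intCast, Int.emod_def]
  push_cast
  linear_combination (-((T / (p : ℤ) : ℤ) : ZMod (p ^ 2))) * (pp_eq_zero (p := p))

/-- `p · n^ = p · n` for naturals. [folklore] -/
theorem p_mul_L_natCast [NeZero p] (n : ℕ) :
    (p : ZMod (p ^ 2)) * L ((n : ZMod p)) = (p : ZMod (p ^ 2)) * (n : ZMod (p ^ 2)) := by
  have := p_mul_L_intCast (p := p) (n : ℤ)
  push_cast at this
  exact this

/-- `t ↦ p·t̂` is additive. [folklore] -/
theorem p_mul_L_add [NeZero p] (a b : ZMod p) :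
    (p : ZMod (p ^ 2)) * L (a + b) = (p : ZMod (p ^ 2)) * L a + (p : ZMod (p ^ 2)) * L b := by
  conv_lhs => rw [← ZMod.natCast_zmod_val a, ← ZMod.natCast_zmod_val b, ← Nat.cast_add, p_mul_L_natCast]
  conv_rhs => rw [← ZMod.natCast_zmod_val a, ← ZMod.natCast_zmod_val b, p_mul_L_natCast, p_mul_L_natCast]
  push_cast; ring

/-- `p·0^ = 0`. [folklore] -/
theorem p_mul_L_zero : (p : ZMod (p ^ 2)) * L (0 : ZMod p) = 0 := by
  simp [L, ZMod.val_zero]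

/-- `t ↦ p·t̂` is odd. [folklore] -/
theorem p_mul_L_neg [NeZero p] (a : ZMod p) : (p : ZMod (p ^ 2)) * L (-a) = -((p : ZMod (p ^ 2)) * L a) := by
  have h := p_mul_L_add (p := p) a (-a)
  rw [add_neg_cancel, p_mul_L_zero] at h
  linear_combination -h

/-- `Mcube p` is a group (`p ≥ 1`). [folklore] -/
instance [NeZero p] : Group (Mcube p) :=
  Group.ofLeftAxioms
    (fun g h k => ext (by simp only [mul_def]; ring) (by
      simp only [mul_def]
      linear_combination k.x * p_mul_L_add (p := p) g.t h.t - (L g.t * L h.t * k.x) * pp_eq_zero (p := p)))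
    (fun g => ext (by simp only [mul_def, one_def, zero_add]) (by
      simp only [mul_def, one_def, p_mul_L_zero, zero_mul, add_zero, zero_add]))
    (fun g => ext (by simp only [mul_def, inv_def, one_def, neg_add_cancel]) (by
      simp only [mul_def, inv_def, one_def]
      linear_combination g.x * p_mul_L_neg (p := p) g.t))

/-- `Mcube p ≃ ℤ/p × ℤ/p²` as types. [folklore] -/
def equivProd : Mcube p ≃ ZMod p × ZMod (p ^ 2) :=
  ⟨fun g => (g.t, g.x), fun q => ⟨q.1, q.2⟩, fun _ => rfl, fun _ => rfl⟩

/-- Finite, through `equivProd`. [folklore] -/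
instance [NeZero p] : Fintype (Mcube p) := Fintype.ofEquiv _ equivProd.symm

/-- `|Mcube p| = p · p² = p³`. [folklore] -/
theorem card [NeZero p] : Fintype.card (Mcube p) = p * p ^ 2 := by
  rw [Fintype.ofEquiv_card, Fintype.card_prod, ZMod.card, ZMod.card]

/-! ### Integer-parametrised elements -/

/-- The element `(T mod p, X)` for an integer `T`. [folklore] -/
def mk' (T : ℤ) (X : ZMod (p ^ 2)) : Mcube p := ⟨(T : ZMod p), X⟩

/-- Product of integer-parametrised elements. [folklore] -/
theorem mk'_mul [NeZero p] (T T' : ℤ) (X X' : ZMod (p ^ 2)) :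
    mk' (p := p) T X * mk' T' X' = mk' (T + T') (X + X' + (p : ZMod (p ^ 2)) * (T : ZMod (p ^ 2)) * X') :=
  ext (by simp only [mk', mul_def]; push_cast; ring) (by simp only [mk', mul_def, p_mul_L_intCast])

/-- Inverse of an integer-parametrised element. [folklore] -/
theorem mk'_inv [NeZero p] (T : ℤ) (X : ZMod (p ^ 2)) :
    (mk' (p := p) T X)⁻¹ = mk' (-T) (-X + (p : ZMod (p ^ 2)) * (T : ZMod (p ^ 2)) * X) :=
  ext (by simp only [mk', inv_def]; push_cast; ring) (by simp only [mk', inv_def, p_mul_L_intCast])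

/-- An integer-parametrised element is `1` iff both coordinates vanish. [folklore] -/
theorem mk'_eq_one (T : ℤ) (X : ZMod (p ^ 2)) : mk' (p := p) T X = 1 ↔ (T : ZMod p) = 0 ∧ X = 0 := by
  rw [one_def, Mcube.ext_iff]; rfl

/-! ### Integer boxes, cells, heights, and the forbidden differences -/

/-- Integer box data: `y_k = (θ_k, η_k)`, `w_l = (φ_l, ω_l)` (`t`-coordinates `θ, φ`, `x`-coordinates `η, ω`). [folklore] -/
structure IBox where
  /-- `t`-coordinates of `y₀,y₁,y₂` -/
  th : Fin 3 → ℤ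
  /-- `x`-coordinates of `y₀,y₁,y₂` -/
  et : Fin 3 → ℤ
  /-- `t`-coordinates of `w₀,w₁,w₂` -/
  ph : Fin 3 → ℤ
  /-- `x`-coordinates of `w₀,w₁,w₂` -/
  om : Fin 3 → ℤ

namespace IBox

variable (B : IBox)

/-- The `Y`-element `y_k`. [folklore] -/
def yM (p : ℕ) (k : Fin 3) : Mcube p := mk' (B.th k) (B.et k : ZMod (p ^ 2))
/-- The `W`-element `w_l`. [folklore] -/
def wM (p : ℕ) (l : Fin 3) : Mcube p := mk' (B.ph l) (B.om l : ZMod (p ^ 2))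

/-- The forbidden height difference `tauI(c,c′) = (θ_k−θ_k′)(η_k+η_k′+ω_l′) + (φ_l−φ_l′)(η_k+ω_l+ω_l′)`. [folklore] -/
def tauI (c c' : Fin 3 × Fin 3) : ℤ :=
  (B.th c.1 - B.th c'.1) * (B.et c.1 + B.et c'.1 + B.om c'.2) + (B.ph c.2 - B.ph c'.2) * (B.et c.1 + B.om c.2 + B.om c'.2)

/-- The cell of column `c = (k,l)` over the class `(t₀, K₁)` at height `h` (all integers). [folklore] -/
def cellM (p : ℕ) (c : Fin 3 × Fin 3) (K₁ t₀ h : ℤ) : Mcube p × Mcube p × Mcube p :=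
  (mk' (t₀ - B.th c.1 - B.ph c.2)
      ((K₁ - B.et c.1 - B.om c.2 + (p : ℤ) * (h - (B.th c.1 + B.ph c.2) * K₁) : ℤ) : ZMod (p ^ 2)),
    B.yM p c.1, B.wM p c.2)

/-- From `p·(X + pR) = 0` in `ℤ/p²` to `p ∣ X`. [folklore] -/
theorem dvd_of_p_mul_cast_eq_zero (hp : p ≠ 0) {X R : ℤ}
    (h : (((p : ℤ) * (X + (p : ℤ) * R) : ℤ) : ZMod (p ^ 2)) = 0) : (p : ℤ) ∣ X := by
  rw [ZMod.intCast_zmod_eq_zero_iff_dvd] at h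
  push_cast at h
  rw [pow_two] at h
  have h1 : (p : ℤ) ∣ X + p * R := Int.dvd_of_mul_dvd_mul_left (by exact_mod_cast hp) h
  have h2 : (p : ℤ) ∣ (p : ℤ) * R := dvd_mul_right _ _
  exact (dvd_add_right h2).mp (by rwa [add_comm] at h1)

/-- The machine-derived remainder polynomial of the height identity (`x`-coordinate of the cell word at equal classes
`= p·((h − h') − tauI + p·Rsub)` in `ℤ/p²`). [folklore] -/
def Rsub (k k' l l' : Fin 3) (K₁ t₀ _h h' : ℤ) (p : ℕ) : ℤ :=
  (B.ph l') ^ 2 * (B.om l') + (B.th k') * (B.ph l') * (B.et k') + (B.th k') ^ 2 * (B.et k') - 2 * (B.ph l) * (B.ph l') * (B.om l') - (B.ph l) * (B.ph l') * (B.et k') - (B.ph l) * (B.th k') * (B.om l') - 2 * (B.ph l) * (B.th k') * (B.et k') + (B.ph l) ^ 2 * (B.om l') - (B.th k) * (B.ph l') * (B.om l') - 2 * (B.th k) * (B.ph l') * (B.et k') - (B.th k) * (B.th k') * (B.om l') - 2 * (B.th k) * (B.th k') * (B.et k') + (B.th k) * (B.ph l) * (B.et k') + (B.th k) ^ 2 *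 (B.et k') - h' * (B.ph l') - h' * (B.th k') + h' * (B.ph l) + h' * (B.th k) + K₁ * (B.ph l') ^ 2 + 2 * K₁ * (B.th k') * (B.ph l') + K₁ * (B.th k') ^ 2 + t₀ * (B.ph l') * (B.om l') + t₀ * (B.ph l') * (B.et k') + t₀ * (B.th k') * (B.om l') + t₀ * (B.th k') * (B.et k') + t₀ * (B.ph l) * (B.om l') + t₀ * (B.ph l) * (B.et k') + t₀ * (B.th k) * (B.om l') + t₀ * (B.th k) * (B.et k') - t₀ * K₁ * (B.ph l') - t₀ * K₁ * (B.th k') - t₀ * K₁ * (B.ph l) - t₀ * K₁ * (B.th k) - t₀ ^ 2 * (B.om l') - t₀ ^ 2 * (B.et k') + t₀ ^ 2 * K₁ + (p:ℤ) * (B.ph l) * (B.ph l') ^ 2 * (B.om l') - (p:ℤ) * (B.ph l) ^ 2 * (B.ph l') * (B.om l') + (p:ℤ) * (B.th k) * (B.th k') * (B.ph l') * (B.et k') + (p:ℤ) * (B.th k) * (B.th k') ^ 2 * (B.et k') - (p:ℤ) * (B.th k) * (B.ph l) * (B.th k') * (B.et k') - (p:ℤ) * (B.th k) ^ 2 * (B.th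 k') * (B.et k') + (p:ℤ) * h' * (B.ph l) * (B.ph l') + (p:ℤ) * h' * (B.ph l) * (B.th k') + (p:ℤ) * h' * (B.th k) * (B.ph l') + (p:ℤ) * h' * (B.th k) * (B.th k') - (p:ℤ) * K₁ * (B.ph l) * (B.ph l') ^ 2 - 2 * (p:ℤ) * K₁ * (B.ph l) * (B.th k') * (B.ph l') - (p:ℤ) * K₁ * (B.ph l) * (B.th k') ^ 2 - (p:ℤ) * K₁ * (B.th k) * (B.ph l') ^ 2 - 2 * (p:ℤ) * K₁ * (B.th k) * (B.th k') * (B.ph l') - (p:ℤ) * K₁ * (B.th k) * (B.th k') ^ 2 - (p:ℤ) * t₀ * h' * (B.ph l') - (p:ℤ) * t₀ * h' * (B.th k') - (p:ℤ) * t₀ * h' * (B.ph l) - (p:ℤ) * t₀ * h' * (B.th k) + (p:ℤ) * t₀ * K₁ * (B.ph l') ^ 2 + 2 * (p:ℤ) * t₀ * K₁ * (B.th k') * (B.ph l') + (p:ℤ) * t₀ * K₁ * (B.th k') ^ 2 + (p:ℤ) * t₀ * K₁ * (B.ph l) * (B.ph l') + (p:ℤ) * t₀ * K₁ * (B.ph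 l) * (B.th k') + (p:ℤ) * t₀ * K₁ * (B.th k) * (B.ph l') + (p:ℤ) * t₀ * K₁ * (B.th k) * (B.th k') + (p:ℤ) * t₀ ^ 2 * h' - (p:ℤ) * t₀ ^ 2 * K₁ * (B.ph l') - (p:ℤ) * t₀ ^ 2 * K₁ * (B.th k')

variable {B}

/-- **Key identity, class part**: interacting cells have the same class `(t₀, K₁)` mod `p`. [folklore] -/
theorem dvd_of_cellWord [NeZero p] {c c' : Fin 3 × Fin 3} {K₁ t₀ h K₁' t₀' h' : ℤ}
    (hw : cellWord (B.cellM p c K₁ t₀ h) (B.cellM p c' K₁' t₀' h') = 1) :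
    (p : ℤ) ∣ t₀ - t₀' ∧ (p : ℤ) ∣ K₁ - K₁' := by
  simp only [cellWord, cellM, yM, wM, mk'_mul, mk'_inv, mk'_eq_one] at hw
  obtain ⟨ht, hx⟩ := hw
  refine ⟨?_, ?_⟩
  · have h1 := (ZMod.intCast_zmod_eq_zero_iff_dvd _ _).1 ht
    have e : t₀ - B.th c.1 - B.ph c.2 + -(t₀' - B.th c'.1 - B.ph c'.2) + (B.th c.1 + -B.th c'.1) +
        (B.ph c.2 + -B.ph c'.2) = t₀ - t₀' := by ring
    rwa [e] at h1
  · have hdvd : p ∣ p ^ 2 := dvd_pow_self p two_ne_zero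
    have hx' := congrArg (ZMod.castHom hdvd (ZMod p)) hx
    simp only [map_add, map_neg, map_mul, map_intCast, map_natCast, map_zero] at hx'
    push_cast at hx'
    simp only [ZMod.natCast_self, zero_mul, add_zero] at hx'
    have h2 : ((K₁ - K₁' : ℤ) : ZMod p) = 0 := by
      push_cast
      linear_combination hx'
    exact (ZMod.intCast_zmod_eq_zero_iff_dvd _ _).1 h2

/-- **Key identity, height part**: interacting cells of the same class have heights differing by `tauI` mod `p`. [folklore] -/
theorem dvd_height_of_cellWord [NeZero p] {c c' : Fin 3 × Fin 3} {K₁ t₀ h h' : ℤ}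
    (hw : cellWord (B.cellM p c K₁ t₀ h) (B.cellM p c' K₁ t₀ h') = 1) : (p : ℤ) ∣ h - h' - B.tauI c c' := by
  simp only [cellWord, cellM, yM, wM, mk'_mul, mk'_inv, mk'_eq_one] at hw
  obtain ⟨-, hx⟩ := hw
  obtain ⟨k, l⟩ := c
  obtain ⟨k', l'⟩ := c'
  refine dvd_of_p_mul_cast_eq_zero (NeZero.ne p) (R := B.Rsub k k' l l' K₁ t₀ h h' p) ?_
  simp only [tauI, Rsub]
  push_cast at hx ⊢
  linear_combination hx

/-! ### Patterns and cell sets -/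

/-- A height pattern is *independent* when no ordered pair of distinct entries sits at a forbidden difference. [folklore] -/
def PatIndepM (p : ℕ) (T : Finset ((Fin 3 × Fin 3) × ZMod p)) : Prop :=
  ∀ a ∈ T, ∀ b ∈ T, a ≠ b → a.2 - b.2 ≠ ((B.tauI a.1 b.1 : ℤ) : ZMod p)

/-- Pattern independence is decidable. [folklore] -/
instance (T : Finset ((Fin 3 × Fin 3) × ZMod p)) [NeZero p] : Decidable (B.PatIndepM p T) := by
  unfold PatIndepM; infer_instance

/-- Nondegeneracy: the three `Y`-elements and the three `W`-elements are distinct. [folklore] -/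
structure NondegM (p : ℕ) : Prop where
  /-- `yM` injective -/
  y_inj : Function.Injective (B.yM p)
  /-- `wM` injective -/
  w_inj : Function.Injective (B.wM p)

/-- The cell set of a pattern: over every entry `(c, h)` the `p²` cells of column `c` at height `h.val`. [folklore] -/
def cellSetM (T : Finset ((Fin 3 × Fin 3) × ZMod p)) : Finset (Mcube p × Mcube p × Mcube p) :=
  T.biUnion fun a => (range p ×ˢ range p).image fun q => B.cellM p a.1 (q.1 : ℤ) (q.2 : ℤ) (a.2.val : ℤ)

/-- Membership in the cell set. [folklore] -/
theorem mem_cellSetM {T : Finset ((Fin 3 × Fin 3) × ZMod p)} {P : Mcube p × Mcube p × Mcube p} :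
    P ∈ B.cellSetM T ↔ ∃ a ∈ T, ∃ K₁ t₀ : ℕ, K₁ < p ∧ t₀ < p ∧ P = B.cellM p a.1 K₁ t₀ (a.2.val : ℤ) := by
  constructor
  · intro hP
    obtain ⟨a, ha, hP⟩ := mem_biUnion.1 hP
    obtain ⟨q, hq, hPq⟩ := mem_image.1 hP
    rw [mem_product, mem_range, mem_range] at hq
    exact ⟨a, ha, q.1, q.2, hq.1, hq.2, hPq.symm⟩
  · rintro ⟨a, ha, K₁, t₀, hK, ht, rfl⟩
    exact mem_biUnion.2 ⟨a, ha, mem_image.2 ⟨(K₁, t₀), by rw [mem_product, mem_range, mem_range]; exact ⟨hK, ht⟩, rfl⟩⟩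

/-- The cell set lies in the box `Mcube p × Y × W`. [folklore] -/
theorem cellSetM_subset [NeZero p] (T : Finset ((Fin 3 × Fin 3) × ZMod p)) :
    B.cellSetM T ⊆ univ ×ˢ ((univ.image (B.yM p)) ×ˢ (univ.image (B.wM p))) := by
  intro P hP
  obtain ⟨a, -, K₁, t₀, -, -, rfl⟩ := B.mem_cellSetM.1 hP
  simp only [cellM, mem_product, mem_univ, true_and, mem_image]
  exact ⟨⟨a.1.1, rfl⟩, ⟨a.1.2, rfl⟩⟩

/-- Integers closer than `p` with `p ∣ a − b` are equal. [folklore] -/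
theorem eq_of_dvd_of_lt {a b : ℤ} (h : (p : ℤ) ∣ a - b) (h1 : a < b + p) (h2 : b < a + p) : a = b := by
  have := Int.eq_zero_of_dvd_of_natAbs_lt_natAbs h (by omega)
  omega

/-- Cells determine their data (nondegenerate box; classes in `[0, p)`). [folklore] -/
theorem cellM_inj [NeZero p] (hB : B.NondegM p) {c c' : Fin 3 × Fin 3} {K₁ t₀ K₁' t₀' : ℕ} {hz hz' : ZMod p}
    (hK : K₁ < p) (hK' : K₁' < p) (ht : t₀ < p) (ht' : t₀' < p)
    (e : B.cellM p c K₁ t₀ (hz.val : ℤ) = B.cellM p c' K₁' t₀' (hz'.val : ℤ)) :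
    c = c' ∧ K₁ = K₁' ∧ t₀ = t₀' ∧ hz = hz' := by
  simp only [cellM, Prod.mk.injEq] at e
  obtain ⟨e1, ey, ew⟩ := e
  have hc : c = c' := Prod.ext (hB.y_inj ey) (hB.w_inj ew)
  subst hc
  rw [mk', mk', Mcube.ext_iff] at e1
  obtain ⟨et, ex⟩ := e1
  have h1 : (p : ℤ) ∣ (t₀ : ℤ) - t₀' := by
    rw [← ZMod.intCast_zmod_eq_zero_iff_dvd]; push_cast at et ⊢; linear_combination et
  have ht0 : (t₀ : ℤ) = t₀' := eq_of_dvd_of_lt h1 (by omega) (by omega)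
  have hD : (p : ℤ) ^ 2 ∣ ((K₁ : ℤ) - K₁') + p * ((hz.val : ℤ) - hz'.val - (B.th c.1 + B.ph c.2) * (K₁ - K₁')) := by
    have h0 : ((((K₁ : ℤ) - K₁') + p * ((hz.val : ℤ) - hz'.val - (B.th c.1 + B.ph c.2) * (K₁ - K₁')) : ℤ) :
        ZMod (p ^ 2)) = 0 := by
      push_cast at ex ⊢; linear_combination ex
    have := (ZMod.intCast_zmod_eq_zero_iff_dvd _ _).1 h0
    exact_mod_cast this
  have hp1 : (p : ℤ) ∣ (K₁ : ℤ) - K₁' :=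
    (dvd_add_left (dvd_mul_right _ _)).mp ((dvd_pow_self (p : ℤ) two_ne_zero).trans hD)
  have hK0 : (K₁ : ℤ) = K₁' := eq_of_dvd_of_lt hp1 (by omega) (by omega)
  have hK1 : K₁ = K₁' := by exact_mod_cast hK0
  subst hK1
  have h4 : (p : ℤ) ∣ (hz.val : ℤ) - hz'.val := by
    rw [sub_self, mul_zero, sub_zero, zero_add, pow_two] at hD
    exact Int.dvd_of_mul_dvd_mul_left (by exact_mod_cast NeZero.ne p) hD
  have hv := ZMod.val_lt hz
  have hv' := ZMod.val_lt hz'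
  have h6 : (hz.val : ℤ) = hz'.val := eq_of_dvd_of_lt h4 (by omega) (by omega)
  exact ⟨rfl, rfl, by exact_mod_cast ht0, ZMod.val_injective p (by exact_mod_cast h6)⟩

/-- The cell set has `#T · p²` cells. [folklore] -/
theorem card_cellSetM [NeZero p] (hB : B.NondegM p) (T : Finset ((Fin 3 × Fin 3) × ZMod p)) :
    #(B.cellSetM T) = #T * (p * p) := by
  rw [cellSetM, card_biUnion]
  · have : ∀ a ∈ T, #((range p ×ˢ range p).image fun q : ℕ × ℕ => B.cellM p a.1 (q.1 : ℤ) (q.2 : ℤ) (a.2.val : ℤ))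
        = p * p := by
      intro a _
      rw [card_image_of_injOn, card_product, card_range]
      rintro ⟨K₁, t₀⟩ hq ⟨K₁', t₀'⟩ hq' e
      simp only [coe_product, coe_range, Set.mem_prod, Set.mem_Iio] at hq hq'
      obtain ⟨-, h1, h2, -⟩ := B.cellM_inj hB hq.1 hq'.1 hq.2 hq'.2 e
      rw [h1, h2]
    rw [sum_congr rfl this, sum_const, smul_eq_mul]
  · intro a _ a' _ haa'
    rw [Function.onFun, disjoint_left]
    intro P hP hP'
    obtain ⟨q, hq, rfl⟩ := mem_image.1 hP
    obtain ⟨q', hq', e⟩ := mem_image.1 hP'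
    simp only [mem_product, mem_range] at hq hq'
    obtain ⟨hc, -, -, hh⟩ := B.cellM_inj hB hq'.1 hq.1 hq'.2 hq.2 e
    exact haa' (Prod.ext hc.symm hh.symm)

/-- An independent pattern gives an independent cell set. [folklore] -/
theorem cellSetM_indep [NeZero p] {T : Finset ((Fin 3 × Fin 3) × ZMod p)} (hT : B.PatIndepM p T) :
    ∀ P ∈ B.cellSetM T, ∀ P' ∈ B.cellSetM T, P ≠ P' → cellWord P P' ≠ 1 := by
  intro P hP P' hP' hne hw
  obtain ⟨a, ha, K₁, t₀, hK, ht, rfl⟩ := B.mem_cellSetM.1 hP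
  obtain ⟨b, hb, K₁', t₀', hK', ht', rfl⟩ := B.mem_cellSetM.1 hP'
  obtain ⟨d1, d2⟩ := dvd_of_cellWord hw
  have e1 : (t₀ : ℤ) = t₀' := eq_of_dvd_of_lt d1 (by omega) (by omega)
  have e2 : (K₁ : ℤ) = K₁' := eq_of_dvd_of_lt d2 (by omega) (by omega)
  have e1' : t₀ = t₀' := by exact_mod_cast e1
  have e2' : K₁ = K₁' := by exact_mod_cast e2
  subst e1' e2'
  have d3 := dvd_height_of_cellWord hw
  by_cases hab : a = b
  · subst hab; exact hne rfl
  · apply hT a ha b hb hab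
    rw [sub_eq_iff_eq_add]
    have : (((a.2.val : ℤ) - b.2.val - B.tauI a.1 b.1 : ℤ) : ZMod p) = 0 :=
      (ZMod.intCast_zmod_eq_zero_iff_dvd _ _).2 d3
    push_cast at this
    rw [ZMod.natCast_zmod_val, ZMod.natCast_zmod_val] at this
    linear_combination this

/-- **The pattern lemma for `M(p³)`**: an independent height pattern with `9p ≤ 5·#T` makes `Mcube p` not box-useful. [folklore] -/
theorem not_boxUseful_of_pattern [NeZero p] (hB : B.NondegM p) {T : Finset ((Fin 3 × Fin 3) × ZMod p)}
    (hT : B.PatIndepM p T) (hbig : 9 * p ≤ 5 * #T) : ¬ BoxUseful (Mcube p) := by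
  refine not_boxUseful_of_indep (Y := univ.image (B.yM p)) (W := univ.image (B.wM p)) (J := B.cellSetM T)
    (by rw [card_image_of_injective _ hB.y_inj, card_univ, Fintype.card_fin])
    (by rw [card_image_of_injective _ hB.w_inj, card_univ, Fintype.card_fin])
    (B.cellSetM_subset T) (B.cellSetM_indep hT) ?_
  rw [B.card_cellSetM hB, Mcube.card, pow_two]
  calc 9 * (p * (p * p)) = (9 * p) * (p * p) := by ring
    _ ≤ (5 * #T) * (p * p) := Nat.mul_le_mul_right _ hbig
    _ = 5 * (#T * (p * p)) := by ring

end IBox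

/-! ### First instance: `p = 5` -/

/-- The uniform box at `p = 5`: `θ = (0,0,−1)`, `η = (0,2,0)`, `φ = (0,−2,0)`, `ω = (0,0,2)`. [folklore] -/
def B5 : IBox := ⟨![0, 0, -1], ![0, 2, 0], ![0, -2, 0], ![0, 0, 2]⟩

/-- An optimal pattern for `M(125)`: `10 = 2·5` heights. [folklore] -/
def TM5 : Finset ((Fin 3 × Fin 3) × ZMod 5) :=
  {((0, 0), 0), ((0, 1), 1), ((0, 2), 4), ((1, 0), 2), ((1, 1), 2), ((1, 2), 1), ((1, 2), 3), ((2, 0), 3),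
    ((2, 1), 2), ((2, 1), 4)}

/-- **`M(125) = ℤ/25 ⋊ ℤ/5` is not box-useful** (`5·10·25 = 1250 ≥ 1125 = 9·125`). [folklore] -/
theorem not_boxUseful_mcube5 : ¬ BoxUseful (Mcube 5) :=
  B5.not_boxUseful_of_pattern (p := 5) ⟨by decide, by decide⟩ (T := TM5) (by decide +kernel) (by decide +kernel)

end Mcube

end Summit.MatrixMultiplication.OmegaCensus
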